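import Mathlib
import HarnessLib

/-!
# Generalised-eigenvector extraction for commuting operators (stub `stub_B2` of line `BaireSketch`)

Crux `HeckeEigenvalueField` (stmt-Langlands-13632), step (B2) of the Baire sketch: pure linear
algebra. Given finitely many pairwise commuting endomorphisms `E i` of a complex vector space `V`,
two `E`-stable subspaces `P` and `F` with `F` finite-dimensional and `E i ≡ c i (mod P)` on `F`, and a
vector `x ∈ F ∖ P`, some element `a` of the algebra generated by the `E i` moves `x` to a vector
`a x ∉ P` killed by a power of every `E i - c i`. The element `a` is a product of the polynomials
`R_i(E i)`, where the characteristic polynomial of `E i` on `F` factors as `(X - c i)^k_i R_i` with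
`R_i(c i) ≠ 0` (Cayley–Hamilton). [folklore]
-/

set_option linter.dupNamespace false

noncomputable section

open Polynomial

namespace Summit.Langlands.Langlands.Theorems.HeckeEigenvalueField.Baire

/-- The iterates of `v ↦ f v - μ • v` are the polynomials `(X - μ)^m` evaluated at `f`. [folklore] -/
theorem iterate_sub_smul_eq_aeval {V : Type*} [AddCommGroup V] [Module ℂ V] (f : Module.End ℂ V)
    (μ : ℂ) (m : ℕ) (v : V) : (fun w => f w - μ • w)^[m] v = aeval f ((X - C μ) ^ m) v := by
  have hfun : (fun w => f w - μ • w) = ⇑(aeval f (X - C μ)) := by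
    funext w
    simp [Module.algebraMap_end_apply]
  rw [hfun, map_pow, Module.End.coe_pow]

/-- An endomorphism commuting with `f` commutes with the iterates of `v ↦ f v - μ • v`. [folklore] -/
theorem iterate_sub_smul_apply_comm {V : Type*} [AddCommGroup V] [Module ℂ V]
    (f g : Module.End ℂ V) (h : Commute f g) (μ : ℂ) (m : ℕ) (v : V) :
    (fun w => f w - μ • w)^[m] (g v) = g ((fun w => f w - μ • w)^[m] v) := by
  rw [iterate_sub_smul_eq_aeval, iterate_sub_smul_eq_aeval]
  have hc : Commute g (aeval f ((X - C μ) ^ m)) :=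
    Algebra.commute_of_mem_adjoin_singleton_of_commute
      (Polynomial.aeval_mem_adjoin_singleton ℂ f) h.symm
  exact (LinearMap.congr_fun hc.eq v).symm

/-- If `f` preserves `F` and acts as the scalar `μ` on `F` modulo `P`, then every polynomial `q(f)`
acts as the scalar `q(μ)` on `F` modulo `P`: `q(f) - q(μ) = (f - μ) r(f)` with `r = q / (X - μ)`.
[folklore] -/
theorem aeval_sub_eval_smul_mem {V : Type*} [AddCommGroup V] [Module ℂ V] (f : Module.End ℂ V)
    (μ : ℂ) (P F : Submodule ℂ V) (hF : ∀ v ∈ F, f v ∈ F)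
    (hc : ∀ v ∈ F, f v - μ • v ∈ P) (q : ℂ[X]) {v : V} (hv : v ∈ F) :
    aeval f q v - q.eval μ • v ∈ P := by
  have hq : C (q.eval μ) + (X - C μ) * (q /ₘ (X - C μ)) = q := by
    rw [← modByMonic_X_sub_C_eq_C_eval, modByMonic_add_div]
  have hw : aeval f (q /ₘ (X - C μ)) v ∈ F :=
    aeval_apply_smul_mem_of_le_comap hv _ f fun w hw => hF w hw
  have key : aeval f q v = q.eval μ • v +
      (f (aeval f (q /ₘ (X - C μ)) v) - μ • aeval f (q /ₘ (X - C μ)) v) := by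
    have h := congrArg (fun p => aeval f p v) hq
    simp only [map_add, map_mul, aeval_C, aeval_X, map_sub, LinearMap.add_apply,
      LinearMap.sub_apply, Module.End.mul_apply, Module.algebraMap_end_apply] at h
    exact h.symm
  rw [key, add_sub_cancel_left]
  exact hc _ hw

/-- Polynomials in `f` restricted to an `f`-stable subspace are the restrictions of the polynomials
in `f`. [folklore] -/
theorem coe_aeval_restrict {V : Type*} [AddCommGroup V] [Module ℂ V] (f : Module.End ℂ V)
    (F : Submodule ℂ V) (hF : ∀ v ∈ F, f v ∈ F) (q : ℂ[X]) (v : F) :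
    ((aeval (f.restrict hF) q v : F) : V) = aeval f q (v : V) := by
  induction q using Polynomial.induction_on' with
  | add p q hp hq => simp only [map_add, LinearMap.add_apply, Submodule.coe_add, hp, hq]
  | monomial n a =>
    simp only [aeval_monomial, Module.End.mul_apply, Module.End.pow_restrict n hF,
      LinearMap.coe_restrict_apply, Module.algebraMap_end_apply, Submodule.coe_smul]

/-- **Cayley–Hamilton on a stable finite-dimensional subspace.** For `f` preserving the
finite-dimensional subspace `F` and a scalar `μ`, there are a polynomial `R` with `R(μ) ≠ 0` and an
exponent `k` with `(f - μ)^k R(f) = 0` on `F`: factor the characteristic polynomial of `f|_F` as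
`(X - μ)^k R`. [folklore] -/
theorem exists_pow_mul_aeval_eq_zero {V : Type*} [AddCommGroup V] [Module ℂ V]
    (f : Module.End ℂ V) (μ : ℂ) (F : Submodule ℂ V) [FiniteDimensional ℂ F]
    (hF : ∀ v ∈ F, f v ∈ F) :
    ∃ R : ℂ[X], ∃ k : ℕ, R.eval μ ≠ 0 ∧ ∀ v ∈ F, aeval f ((X - C μ) ^ k * R) v = 0 := by
  refine ⟨(f.restrict hF).charpoly /ₘ (X - C μ) ^ (f.restrict hF).charpoly.rootMultiplicity μ,
    (f.restrict hF).charpoly.rootMultiplicity μ,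
    eval_divByMonic_pow_rootMultiplicity_ne_zero μ (f.restrict hF).charpoly_monic.ne_zero,
    fun v hv => ?_⟩
  rw [pow_mul_divByMonic_rootMultiplicity_eq]
  have h := coe_aeval_restrict f F hF (f.restrict hF).charpoly ⟨v, hv⟩
  rw [LinearMap.aeval_self_charpoly, LinearMap.zero_apply, Submodule.coe_zero] at h
  exact h.symm

/-- The inductive core of `stub_B2`: for every finite set `s` of indices there is an element `a` of
the algebra generated by the commuting `E i` which preserves `F`, acts on `F` modulo `P` as a
nonzero scalar, and maps `F` to vectors killed by a common power of the `E i - c i`, `i ∈ s`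
(stability of `P` under the `E i` is not needed). [folklore] -/
theorem exists_mem_adjoin_finset {V : Type*} [AddCommGroup V] [Module ℂ V] {ι₀ : Type*}
    (E : ι₀ → Module.End ℂ V) (hE : ∀ i j, Commute (E i) (E j)) (c : ι₀ → ℂ)
    (P F : Submodule ℂ V) [FiniteDimensional ℂ F] (hFE : ∀ i, ∀ v ∈ F, E i v ∈ F)
    (hc : ∀ i, ∀ v ∈ F, E i v - c i • v ∈ P) (s : Finset ι₀) :
    ∃ a ∈ Algebra.adjoin ℂ (Set.range E), (∀ v ∈ F, a v ∈ F) ∧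
      (∃ t : ℂ, t ≠ 0 ∧ ∀ v ∈ F, a v - t • v ∈ P) ∧
      ∃ m : ℕ, ∀ i ∈ s, ∀ v ∈ F, (fun w => E i w - c i • w)^[m] (a v) = 0 := by
  classical
  induction s using Finset.induction_on with
  | empty =>
    exact ⟨1, Subalgebra.one_mem _, fun v hv => hv, ⟨1, one_ne_zero, fun v _ => by simp⟩, 0,
      fun i hi => (Finset.notMem_empty i hi).elim⟩
  | insert i s _ ih =>
    obtain ⟨a, haA, haF, ⟨t, ht, hat⟩, m, hm⟩ := ih
    obtain ⟨R, k, hR, hk⟩ := exists_pow_mul_aeval_eq_zero (E i) (c i) F (hFE i)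
    refine ⟨aeval (E i) R * a, mul_mem ?_ haA, fun v hv => ?_,
      ⟨R.eval (c i) * t, mul_ne_zero hR ht, fun v hv => ?_⟩, m + k, fun j hj v hv => ?_⟩
    · exact Algebra.adjoin_mono (Set.singleton_subset_iff.mpr (Set.mem_range_self i))
        (Polynomial.aeval_mem_adjoin_singleton ℂ (E i))
    · exact aeval_apply_smul_mem_of_le_comap (haF v hv) R (E i) fun w hw => hFE i w hw
    · have h1 := aeval_sub_eval_smul_mem (E i) (c i) P F (hFE i) (hc i) R (haF v hv)
      have h2 := P.smul_mem (R.eval (c i)) (hat v hv)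
      have h12 : (aeval (E i) R * a) v - (R.eval (c i) * t) • v =
          (aeval (E i) R (a v) - R.eval (c i) • a v) + R.eval (c i) • (a v - t • v) := by
        rw [Module.End.mul_apply, smul_sub, mul_smul]
        abel
      rw [h12]
      exact P.add_mem h1 h2
    · rcases Finset.mem_insert.mp hj with rfl | hj
      · rw [Function.iterate_add_apply, Module.End.mul_apply]
        have h0 : (fun w => E j w - c j • w)^[k] (aeval (E j) R (a v)) = 0 := by
          rw [iterate_sub_smul_eq_aeval, ← Module.End.mul_apply, ← map_mul]
          exact hk (a v) (haF v hv)
        rw [h0]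
        exact Function.iterate_fixed (by simp) m
      · have hcomm : Commute (E j) (aeval (E i) R) :=
          Algebra.commute_of_mem_adjoin_singleton_of_commute
            (Polynomial.aeval_mem_adjoin_singleton ℂ (E i)) (hE j i)
        have h0 : (fun w => E j w - c j • w)^[m + k] (a v) = 0 := by
          rw [Nat.add_comm, Function.iterate_add_apply, hm j hj v hv]
          exact Function.iterate_fixed (by simp) k
        rw [Module.End.mul_apply, iterate_sub_smul_apply_comm _ _ hcomm, h0, map_zero]

/-- **Generalised-eigenvector extraction** (step (B2) of the Baire sketch for the Hecke eigenvalue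
field). Let `E i` be finitely many pairwise commuting endomorphisms of a complex vector space `V`,
`P` and `F` two `E`-stable subspaces with `F` finite-dimensional, and suppose each `E i` acts on `F`
as the scalar `c i` modulo `P`. Then every `x ∈ F ∖ P` is moved by some element `a` of the algebra
generated by the `E i` to a vector `a x ∉ P` which is killed by a common power of all the
`E i - c i`. [folklore] -/
theorem stub_B2 {V : Type*} [AddCommGroup V] [Module ℂ V] {ι₀ : Type*} [Fintype ι₀]
    (E : ι₀ → Module.End ℂ V) (hE : ∀ i j v, E i (E j v) = E j (E i v)) (c : ι₀ → ℂ)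
    (P F : Submodule ℂ V) [FiniteDimensional ℂ F]
    (hPE : ∀ i, ∀ v ∈ P, E i v ∈ P) (hFE : ∀ i, ∀ v ∈ F, E i v ∈ F)
    (hc : ∀ i, ∀ v ∈ F, E i v - c i • v ∈ P) {x : V} (hxF : x ∈ F) (hxP : x ∉ P) :
    ∃ a ∈ Algebra.adjoin ℂ (Set.range E), a x ∉ P ∧
      ∃ m : ℕ, ∀ i, (fun v => E i v - c i • v)^[m] (a x) = 0 := by
  -- the stability `hPE` of `P` under the `E i` (part of the registered signature) is not needed
  have _ := hPE
  have hE' : ∀ i j, Commute (E i) (E j) := fun i j =>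
    show E i * E j = E j * E i from LinearMap.ext (hE i j)
  obtain ⟨a, haA, -, ⟨t, ht, hat⟩, m, hm⟩ :=
    exists_mem_adjoin_finset E hE' c P F hFE hc Finset.univ
  refine ⟨a, haA, fun haP => hxP ?_, m, fun i => hm i (Finset.mem_univ i) x hxF⟩
  have h : t • x ∈ P := by
    have h' := P.sub_mem haP (hat x hxF)
    rwa [sub_sub_cancel] at h'
  exact (P.smul_mem_iff ht).mp h

end Summit.Langlands.Langlands.Theorems.HeckeEigenvalueField.Baire

end
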